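import Summits.ResolutionOfSingularities.ResolutionOfSingularities.Theses.WildQuotients
import Summits.ResolutionOfSingularities.ResolutionOfSingularities.Theorems.PAlterationAssembly
import Literature.AlgebraicGeometry.Resolution.AlterationsResolution
import Literature.AlgebraicGeometry.Resolution.AlterationsPurelyInseparable
import Literature.AlgebraicGeometry.Resolution.AlterationsProofs

/-!
# Disproof of `SummitReduction` (crux `stmt-ResolutionOfSingularities-16324`, route `WildQuotients`) — findings

Standing adversary work file (cdisprove gen 1, cycle 1, 2026-08-16,
refuter-cdisprove-stmt-ResolutionOfSingularities-16324-0). Prose only in docstrings; every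
`theorem` below is sorry-free (there are no near-misses: nothing here CAN be a near-miss, see §A).

LANDED (importable; ideators / planners / provers may `import` it):
* `Summits.ResolutionOfSingularities.ResolutionOfSingularities.Theorems.SummitReduction.Negative.CounterexampleShape`
  (p129510 ACCEPTED 2026-08-16, commit 86aa36f75940; def-free versions of §A, §B, §C below — names
  `not_resolutionOfSingularities_of_not_summitReduction`, `not_summitReduction_iff`,
  `exists_integral_not_hasResolution_of_not_summitReduction`, `exists_dim_gt_three_of_not_summitReduction`,
  `not_summitReduction_iff_galoisSide`, `not_pialt_of_not_summitReduction`,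
  `not_galoisReduction_of_not_summitReduction`, `not_galoisQuotientAlteration_of_not_summitReduction`,
  `wq_imp_summit_iff`, `picover_imp_summit_iff`, `summitReduction_trivial_without_isRegular_upstairs`,
  `summitReduction_trivial_without_surjective_upstairs`; namespace `…Theorems.SummitReduction.Negative`).

THE CRUX. `SummitReduction` = `∀ p prime, WQ_p → PICover_p → ResolutionInChar p`, where `WQ_p` is the
body of `WildQuotientResolution` at `p` (Galois-type quotients `X₁` of REGULAR integral `X'` by finite
groups have resolutions) and `PICover_p` the body of `Picover` at `p` (finite radicial covers of regular
varieties have resolutions) — both VERBATIM (`summitReduction_iff` is `Iff.rfl`).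

FINDINGS (section by section).
* §0 Unfolding: per-prime bodies `WQAt`, `PicoverAt`, `PialtAt`, `GQAAt`; the route decls are these,
  prime by prime (`Iff.rfl` ×5).
* §A SHAPE OF A COUNTEREXAMPLE (proved). `¬ SummitReduction ↔ ∃ p prime, WQ_p ∧ PICover_p ∧
  ¬ ResolutionInChar p` (`not_summitReduction_iff`): a disproof must PROVE the two open cruxes of the
  route at some prime AND refute resolution of singularities at that prime. Hence
  `¬ SummitReduction → ¬ ResolutionOfSingularities` and the witness is an INTEGRAL separated
  finite-type variety without weak resolution (`exists_integral_not_hasResolution_of_not_summitReduction`,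
  via the in-tree reduced → integral descent), of dimension `≥ 4` modulo `CossartPiltant2019`
  (`exists_dim_gt_three_of_not_summitReduction`). Barrier `DimensionFourFrontier` applies verbatim.
* §B THE EXACT OPEN CONTENT (proved). `SummitReduction ↔ ∀ p prime, WQ_p → PICover_p → PIAlt_p`
  (`summitReduction_iff_galoisSide`; ← is pAlteration's PROVED frame `Theorems.hasResolution_of_thesis`
  + `DescentReducedToIntegral_holds`, → is "a resolution is a p.i. regular alteration"). So the crux is
  "WQ ∧ Picover ⇒ Abramovich–Oort, prime by prime"; the route proves the stronger `WQ_p → PIAlt_p`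
  (support `GaloisReduction`) from de Jong. Certified: `GQA_p ∧ WQ_p → PIAlt_p`
  (`pialtAt_of_gqaAt_of_wqAt`: resolve `X₁ = X'/G` by WQ, compose with `φ : X₁ → X` using the tree's
  `IsPurelyInseparableAlteration.comp`), hence `¬ SummitReduction → ¬ GaloisQuotientAlteration`
  (`not_galoisQuotientAlteration_of_not_summitReduction`) and `¬ SummitReduction → ¬ Pialt`.
  A KILL OF THIS CRUX IS A COUNTEREXAMPLE TO de Jong 1997 Cor. 5.15 AS TYPED (support item
  stmt-16323) at a prime where WQ and Picover hold — i.e. to a published theorem, whose transcription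
  was re-read against the print (below).
* §C LOAD-BEARING HYPOTHESES. Both antecedents are bodies of OPEN cruxes; dropping either leaves an
  implication with conclusion `ResolutionInChar p`, irrefutable without a counterexample to resolution:
  `SummitReductionWithoutPicover ↔ ∀ p, WQ_p → PIAlt_p ∧ PICover_p` (`withoutPicover_iff`: WQ alone
  would have to deliver the inseparable residue Picover — the classical death point of the alteration
  programme) and `SummitReductionWithoutWQ ↔ ∀ p, PICover_p → PIAlt_p` (`withoutWQ_iff`: Picover alone
  would have to deliver Abramovich–Oort). No `_false_without_` theorem is possible for either (each
  negation again contains `¬ ResolutionInChar p`) — recorded as `not_resolutionOfSingularities_of_not_without*`.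
  `p.Prime` is NOT load-bearing (`allNat_iff`: non-prime `p ≠ 0` have no fields, `p = 0` is a
  char-0 instance). INSIDE the antecedent `WQ_p`, the hypothesis `Scheme.IsRegular X'` is what makes the
  crux non-trivial: with it deleted the crux is provable in two lines (`summitReduction_trivial_without_
  isRegular_upstairs`: `X' = X₁ = X`, `G = 1`, `q = 𝟙`), and likewise `Function.Surjective q.base`
  (`summitReduction_trivial_without_surjective_upstairs`: `X' = Spec κ(x)` a closed point, `U = X ∖ {x}`).
* §D TRANSCRIPTION AUDIT of the only unproved input (de Jong 1997, doi:10.5802/aif.1575, read pp.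
  613, 619–620 from the held text): 5.3 (Galois alteration of `(S,G)`: alteration `π`, `G' ↠ G`,
  `R(S)^G ⊂ R(S')^{G'}` purely inseparable), (5.12.1), Thm 5.13 (excellent `S` of finite dimension,
  `f` finite type separated with geometrically irreducible generic fibre), Cor 5.15 ("Any integral scheme
  `X` separated and of finite type over an excellent scheme `S` with `dim S ≤ 2` satisfies (5.12.1) with
  `G = {1}`") — `S = Spec k` for ANY field `k` (excellent, dimension 0): no perfectness needed; the
  proof of 5.13 (p. 620) first makes `X` quasi-projective (equivariant Chow) and projective, and 5.9 (i),
  5.11 are projective, so `X'` is quasi-projective over `k` and `X'/G` exists (SGA 1 V.1 / Mumford AV §7)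
  — in tree as the named facts `DeJong1997_galoisAlteration(QuasiProjective)`. Remaining formal gap for
  the prover of stmt-16323: the scheme quotient by a finite group (fibres = orbits, finite, surjective,
  of finite type; étale over the free locus after replacing `G` by its faithful image, SGA 1 V.2). None of
  these is a place where the statement can be FALSE.

NEXT TARGETS (line picked 2026-08-16T22:28Z, `PICKED.md`: FramePerfect — de Jong input as the named
fact `DeJong1997_galoisAlterationQuasiProjective` over PERFECT fields, stubs: G-stable affine cover /
`ActionOver.glued` quotient / generic étaleness from faithfulness via augmentation ideals / `φ` finite
radicial over a dense open / composition). No skeleton registered yet; on re-arm the `-- Targets`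
section below receives the stub signatures. Pre-audit (paper): all five stubs are sound as described —
(3) needs the FAITHFUL image of `G` (an invariant `a ≠ 0` in every augmentation ideal `I_g`, `g ≠ 1`,
exists iff every `g ≠ 1` moves some section: take `∏_{g≠1} N(b_g)`, `0 ≠ b_g ∈ I_g`, `N` = norm, using
`b_g ∣ N(b_g)`), and (2) needs `X'` SEPARATED for `⋂_g g(V)` to be affine — both available from the
named fact (`IsAlteration π` is proper over the separated `X`).

WHY IT RESISTS. `ResolutionOfSingularities ⇒ SummitReduction ⇐ GaloisQuotientAlteration (de Jong 5.15
+ SGA 1 V.1)`, and `¬ SummitReduction ⇒ WQ_p ∧ PICover_p ∧ ¬ ResolutionInChar p ∧ ¬ GQA_p` at one prime: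
every cheap attack (degenerate `p`, junk in the binders, dropping an antecedent) either lands in an open
problem or in a published theorem. No kill; no conditional kill either (there is no hypothesis `H`
under which de Jong's theorem fails).

## Sources
* A. J. de Jong, Ann. Inst. Fourier 47 (1997) 599–621 (doi:10.5802/aif.1575): 5.3 p. 613; (5.12.1),
  Thm 5.13 pp. 619–620 (proof p. 620); Cor 5.15 p. 620.
* D. Bergh, D. Rydh, arXiv:1905.00872 §1 Thm 1.1 (de Jong's theorem, any field).
* SGA 1 Exp. V §1–2 (quotients by finite groups; étale over the inertia-free locus).
* M. Temkin, J. Algebra 373 (2013), Conj. 1.3.1, §1 (i) ⊂ (iii) (a resolution is a p.i. alteration).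
* V. Cossart, O. Piltant, J. Algebra 529 (2019), Thm 1.1 (named fact `CossartPiltant2019`).
* In tree: `Theorems.hasResolution_of_thesis` (pAlteration Theorem B, every field),
  `PAlteration.DescentReducedToIntegral_holds`, `IsPurelyInseparableAlteration.comp`,
  `Cruxes/SummitReduction/FramePerfectIdeator1.lean` (ideator: the frame needs PIAlt over PERFECT
  fields only — so a counterexample would even need de Jong to fail over a perfect field).
-/

noncomputable section

-- single-problem summit: the doubled namespace component `ResolutionOfSingularities` is forced
set_option linter.dupNamespace false

open CategoryTheory AlgebraicGeometry TopologicalSpace Topology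
open Literature.AlgebraicGeometry.Resolution

namespace Summit.ResolutionOfSingularities.ResolutionOfSingularities.Cruxes.SummitReduction.Disproof

open Summit.ResolutionOfSingularities.ResolutionOfSingularities.Theses.WildQuotients
  (SummitReduction WildQuotientResolution Picover Pialt GaloisReduction GaloisQuotientAlteration)

/-! ## §0 The crux unfolded, prime by prime -/

/-- `WQ_p`: the body of `WildQuotientResolution` at the prime `p` (Galois-type quotients of regular
integral schemes by finite groups have resolutions). -/
def WQAt (p : ℕ) : Prop :=
  ∀ (k : Type) [Field k] [CharP k p] (X' X₁ : Scheme.{0}) (f : X₁ ⟶ Spec (.of k)) (q : X' ⟶ X₁)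
    (G : Type) [Group G] [Finite G] (ρ : G →* Aut X'), IsSeparated f → LocallyOfFiniteType f →
    QuasiCompact f → IsIntegral X₁ → IsIntegral X' → Scheme.IsRegular X' → IsFinite q →
    Function.Surjective q.base → (∃ U : X₁.Opens, Dense (U : Set X₁) ∧ Etale (q ∣_ U)) →
    (∀ g : G, (ρ g).hom ≫ q = q) → (∀ x y : X', q.base x = q.base y → ∃ g : G, (ρ g).hom.base x = y) →
    Scheme.HasResolution X₁

/-- `PICover_p`: the body of `Picover` at `p` (finite radicial covers of regular varieties have
resolutions). -/
def PicoverAt (p : ℕ) : Prop :=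
  ∀ (k : Type) [Field k] [CharP k p] (Y X : Scheme.{0}) (f : Y ⟶ Spec (.of k)) (g : X ⟶ Y),
    IsSeparated f → LocallyOfFiniteType f → QuasiCompact f → IsIntegral Y → Scheme.IsRegular Y →
    IsIntegral X → IsFinite g → UniversallyInjective g → Function.Surjective g.base →
    Scheme.HasResolution X

/-- `PIAlt_p`: the body of the target `Pialt` (Abramovich–Oort) at `p`. -/
def PialtAt (p : ℕ) : Prop :=
  ∀ (k : Type) [Field k] [CharP k p] (X : Scheme.{0}) (f : X ⟶ Spec (.of k)), IsSeparated f →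
    LocallyOfFiniteType f → QuasiCompact f → IsIntegral X → ∃ (X' : Scheme.{0}) (g : X' ⟶ X),
    IsProper g ∧ IsIntegral X' ∧ Scheme.IsRegular X' ∧ Function.Surjective g.base ∧
    ∃ U : X.Opens, Dense (U : Set X) ∧ IsFinite (g ∣_ U) ∧ UniversallyInjective (g ∣_ U)

/-- `GQA_p`: the body of the support `GaloisQuotientAlteration` (de Jong 1997 Cor 5.15 + SGA 1 V.1, as
typed by the route) at `p`. -/
def GQAAt (p : ℕ) : Prop :=
  ∀ (k : Type) [Field k] [CharP k p] (X : Scheme.{0}) (f : X ⟶ Spec (.of k)), IsSeparated f →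
    LocallyOfFiniteType f → QuasiCompact f → IsIntegral X → ∃ (X' X₁ : Scheme.{0}) (q : X' ⟶ X₁)
    (φ : X₁ ⟶ X) (G : Type) (_ : Group G) (_ : Finite G) (ρ : G →* Aut X'),
    IsSeparated (φ ≫ f) ∧ LocallyOfFiniteType (φ ≫ f) ∧ QuasiCompact (φ ≫ f) ∧ IsIntegral X₁ ∧
    IsIntegral X' ∧ Scheme.IsRegular X' ∧ IsFinite q ∧ Function.Surjective q.base ∧
    (∃ U : X₁.Opens, Dense (U : Set X₁) ∧ Etale (q ∣_ U)) ∧ (∀ g : G, (ρ g).hom ≫ q = q) ∧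
    (∀ x y : X', q.base x = q.base y → ∃ g : G, (ρ g).hom.base x = y) ∧ IsProper φ ∧
    Function.Surjective φ.base ∧ ∃ V : X.Opens, Dense (V : Set X) ∧ IsFinite (φ ∣_ V) ∧
    UniversallyInjective (φ ∣_ V)

/-- The crux is, verbatim, `∀ p prime, WQ_p → PICover_p → ResolutionInChar p`. -/
theorem summitReduction_iff :
    SummitReduction ↔ ∀ p : ℕ, p.Prime → WQAt p → PicoverAt p → ResolutionInChar.{0} p :=
  Iff.rfl

/-- `WildQuotientResolution` is `∀ p prime, WQ_p`. -/
theorem wildQuotientResolution_iff : WildQuotientResolution ↔ ∀ p : ℕ, p.Prime → WQAt p := Iff.rfl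

/-- `Picover` is `∀ p prime, PICover_p`. -/
theorem picover_iff : Picover ↔ ∀ p : ℕ, p.Prime → PicoverAt p := Iff.rfl

/-- `Pialt` is `∀ p prime, PIAlt_p`. -/
theorem pialt_iff : Pialt ↔ ∀ p : ℕ, p.Prime → PialtAt p := Iff.rfl

/-- `GaloisQuotientAlteration` is `∀ p prime, GQA_p`. -/
theorem galoisQuotientAlteration_iff : GaloisQuotientAlteration ↔ ∀ p : ℕ, p.Prime → GQAAt p :=
  Iff.rfl

/-! ## §A Shape of a counterexample: the summit implies the crux -/

/-- **A disproof of the crux is a disproof of the summit**: if resolution holds in every prime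
characteristic the implication holds regardless of its antecedents. -/
theorem not_resolutionOfSingularities_of_not_summitReduction (h : ¬ SummitReduction) :
    ¬ _root_.ResolutionOfSingularities :=
  fun hR => h fun p hp _ _ => (_root_.ResolutionOfSingularities_iff.mp hR) p hp

/-- **The exact shape of a counterexample**: a prime `p` at which BOTH open cruxes of the route hold
(wild quotient resolution and Picover) and resolution of singularities FAILS. -/
theorem not_summitReduction_iff :
    ¬ SummitReduction ↔ ∃ p : ℕ, p.Prime ∧ WQAt p ∧ PicoverAt p ∧ ¬ ResolutionInChar.{0} p := by
  constructor
  · intro h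
    by_contra hcon
    exact h fun p hp hW hP => by_contra fun hR => hcon ⟨p, hp, hW, hP, hR⟩
  · rintro ⟨p, hp, hW, hP, hR⟩ h
    exact hR (h p hp hW hP)

/-- Reduced → integral (the route-independent descent `DescentReducedToIntegral_holds`, proved in
tree): a failure of resolution in characteristic `p` is witnessed by an INTEGRAL variety. -/
theorem exists_integral_not_hasResolution_of_not_resolutionInChar {p : ℕ}
    (h : ¬ ResolutionInChar.{0} p) :
    ∃ (k : Type) (_ : Field k) (_ : CharP k p) (X : Scheme.{0}) (f : X ⟶ Spec (.of k)),
      IsSeparated f ∧ LocallyOfFiniteType f ∧ QuasiCompact f ∧ IsIntegral X ∧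
        ¬ Scheme.HasResolution X := by
  by_contra hcon
  apply h
  intro k _ _ X f hs hl hq hr
  refine Theses.PAlteration.DescentReducedToIntegral_holds k ?_ X f hs hl hq hr
  intro Y g hs' hl' hq' hi'
  by_contra hY
  exact hcon ⟨k, inferInstance, inferInstance, Y, g, hs', hl', hq', hi', hY⟩

/-- **Any witness against the crux contains an integral separated finite-type variety over a field of
characteristic `p` without a weak resolution** (at a prime where WQ and Picover hold). -/
theorem exists_integral_not_hasResolution_of_not_summitReduction (h : ¬ SummitReduction) :
    ∃ p : ℕ, p.Prime ∧ WQAt p ∧ PicoverAt p ∧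
      ∃ (k : Type) (_ : Field k) (_ : CharP k p) (X : Scheme.{0}) (f : X ⟶ Spec (.of k)),
        IsSeparated f ∧ LocallyOfFiniteType f ∧ QuasiCompact f ∧ IsIntegral X ∧
          ¬ Scheme.HasResolution X := by
  obtain ⟨p, hp, hW, hP, hR⟩ := not_summitReduction_iff.mp h
  exact ⟨p, hp, hW, hP, exists_integral_not_hasResolution_of_not_resolutionInChar hR⟩

/-- **Dimension `≥ 4`** (modulo the named fact `CossartPiltant2019`): the integral witness is not of
dimension `≤ 3` — barrier `Literature.Barriers.ResolutionOfSingularities.DimensionFourFrontier`. -/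
theorem exists_dim_gt_three_of_not_summitReduction (hCP : CossartPiltant2019.{0})
    (h : ¬ SummitReduction) :
    ∃ p : ℕ, p.Prime ∧ WQAt p ∧ PicoverAt p ∧
      ∃ (k : Type) (_ : Field k) (_ : CharP k p) (X : Scheme.{0}) (f : X ⟶ Spec (.of k)),
        IsSeparated f ∧ LocallyOfFiniteType f ∧ QuasiCompact f ∧ IsIntegral X ∧
          ¬ topologicalKrullDim X ≤ 3 ∧ ¬ Scheme.HasResolution X := by
  obtain ⟨p, hp, hW, hP, k, _, _, X, f, hs, hl, hq, hi, hX⟩ :=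
    exists_integral_not_hasResolution_of_not_summitReduction h
  refine ⟨p, hp, hW, hP, k, inferInstance, inferInstance, X, f, hs, hl, hq, hi, fun hdim => hX ?_, hX⟩
  haveI := hs; haveI := hl; haveI := hq
  exact hasResolution_of_dim_le_three hCP k X f hdim

/-! ## §B The exact open content: the Galois side, prime by prime -/

/-- pAlteration's PROVED per-prime frame (`Theorems.hasResolution_of_thesis` = Theorem B, every field;
`DescentReducedToIntegral_holds`): `PIAlt_p ∧ PICover_p ⇒ ResolutionInChar p`. -/
theorem resolutionInChar_of_pialtAt_of_picoverAt {p : ℕ} (hp : p.Prime) (hPI : PialtAt p)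
    (hPC : PicoverAt p) : ResolutionInChar.{0} p := by
  haveI : Fact p.Prime := ⟨hp⟩
  intro k _ _ X f hs hl hq hr
  exact Theses.PAlteration.DescentReducedToIntegral_holds k (fun Y g h1 h2 h3 h4 => by
    haveI := h1; haveI := h2; haveI := h3; haveI := h4
    exact Theorems.hasResolution_of_thesis p hPI hPC g) X f hs hl hq hr

/-- A resolution IS a purely inseparable regular alteration: `ResolutionInChar p ⇒ PIAlt_p`. -/
theorem pialtAt_of_resolutionInChar {p : ℕ} (h : ResolutionInChar.{0} p) : PialtAt p := by
  intro k _ _ X f hs hl hq hi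
  obtain ⟨Y, φ, hφ, hreg⟩ :=
    (h k X f hs hl hq inferInstance).exists_isPurelyInseparableAlteration_and_isRegular
  exact ⟨Y, φ, hφ.isProper, hφ.isIntegral, hreg, hφ.surjective.1, hφ.exists_dense⟩

/-- `ResolutionInChar p ⇒ PICover_p` (resolve `X` directly: it is integral, separated and of finite
type over `k`, being finite over `Y`). -/
theorem picoverAt_of_resolutionInChar {p : ℕ} (h : ResolutionInChar.{0} p) : PicoverAt p := by
  intro k _ _ Y X f g hs hl hq _ _ hi hfin _ _
  haveI := hs; haveI := hl; haveI := hq; haveI := hfin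
  exact h k X (g ≫ f) inferInstance inferInstance inferInstance inferInstance

/-- `ResolutionInChar p ⇒ WQ_p` (resolve `X₁` directly). -/
theorem wqAt_of_resolutionInChar {p : ℕ} (h : ResolutionInChar.{0} p) : WQAt p := by
  intro k _ _ X' X₁ f q G _ _ ρ hs hl hq hi1 _ _ _ _ _ _ _
  exact h k X₁ f hs hl hq inferInstance

/-- **THE CRUX IS EXACTLY "WQ ∧ Picover ⇒ Abramovich–Oort, prime by prime"**:
`SummitReduction ↔ ∀ p prime, WQ_p → PICover_p → PIAlt_p`. The route intends the stronger
`WQ_p → PIAlt_p` (support `GaloisReduction`, de Jong 1997); Picover is consumed only by the frame. -/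
theorem summitReduction_iff_galoisSide :
    SummitReduction ↔ ∀ p : ℕ, p.Prime → WQAt p → PicoverAt p → PialtAt p := by
  constructor
  · intro h p hp hW hP
    exact pialtAt_of_resolutionInChar (h p hp hW hP)
  · intro h p hp hW hP
    exact resolutionInChar_of_pialtAt_of_picoverAt hp (h p hp hW hP) hP

/-- So a witness against the crux is a prime where WQ and Picover hold and Abramovich–Oort FAILS. -/
theorem exists_not_pialtAt_of_not_summitReduction (h : ¬ SummitReduction) :
    ∃ p : ℕ, p.Prime ∧ WQAt p ∧ PicoverAt p ∧ ¬ PialtAt p := by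
  obtain ⟨p, hp, hW, hP, hR⟩ := not_summitReduction_iff.mp h
  exact ⟨p, hp, hW, hP, fun hPI => hR (resolutionInChar_of_pialtAt_of_picoverAt hp hPI hP)⟩

/-- **A disproof of the crux disproves the route's TARGET `Pialt`** (Abramovich–Oort 2000 Q. 2.13 /
Temkin 2013 Conj. 1.3.1, char-`p` slice — open, believed true). -/
theorem not_pialt_of_not_summitReduction (h : ¬ SummitReduction) : ¬ Pialt := by
  obtain ⟨p, hp, -, -, hPI⟩ := exists_not_pialtAt_of_not_summitReduction h
  exact fun hP => hPI (hP p hp)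

/-- … and, given `WildQuotientResolution`, disproves the support `GaloisReduction` (`WQ → Pialt`). -/
theorem not_galoisReduction_of_not_summitReduction (h : ¬ SummitReduction)
    (hW : WildQuotientResolution) : ¬ GaloisReduction :=
  fun hGR => not_pialt_of_not_summitReduction h (hGR hW)

/-- **The composition step of `GaloisReduction`, certified**: de Jong's datum as typed (`GQA_p`)
together with `WQ_p` gives `PIAlt_p` — resolve `X₁ = X'/G` by WQ (its binders are GQA's conjuncts
verbatim, with structure map `φ ≫ f`) and compose the resolution `Y → X₁` (a p.i. alteration,
`IsResolution.isPurelyInseparableAlteration`) with the generically finite radicial `φ : X₁ → X`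
(`IsPurelyInseparableAlteration.comp`, in tree). -/
theorem pialtAt_of_gqaAt_of_wqAt {p : ℕ} (hG : GQAAt p) (hW : WQAt p) : PialtAt p := by
  intro k _ _ X f hs hl hq hi
  obtain ⟨X', X₁, q, φ, G, _, _, ρ, hs1, hl1, hq1, hi1, hi', hreg, hfin, hsurj, hU, hinv, horb, hprop,
    hφsurj, V, hV, hVfin, hVui⟩ := hG k X f hs hl hq hi
  obtain ⟨Y, π, hπ⟩ := hW k X' X₁ (φ ≫ f) q G ρ hs1 hl1 hq1 hi1 hi' hreg hfin hsurj hU hinv horb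
  haveI := hi1
  haveI := hprop
  haveI : Surjective φ := ⟨hφsurj⟩
  have h1 : IsPurelyInseparableAlteration π := hπ.isPurelyInseparableAlteration
  have h2 : IsPurelyInseparableAlteration φ := ⟨hi1, hprop, inferInstance, V, hV.nonempty, hVfin, hVui⟩
  have h12 : IsPurelyInseparableAlteration (π ≫ φ) := h1.comp h2
  exact ⟨Y, π ≫ φ, h12.isProper, h12.isIntegral, hπ.isRegular, h12.surjective.1, h12.exists_dense⟩

/-- **A disproof of the crux is a counterexample to de Jong's Galois alteration theorem AS TYPED by the
route (support `GaloisQuotientAlteration`, stmt-16323)**, at a prime where WQ and Picover hold. -/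
theorem exists_not_gqaAt_of_not_summitReduction (h : ¬ SummitReduction) :
    ∃ p : ℕ, p.Prime ∧ WQAt p ∧ PicoverAt p ∧ ¬ PialtAt p ∧ ¬ GQAAt p := by
  obtain ⟨p, hp, hW, hP, hPI⟩ := exists_not_pialtAt_of_not_summitReduction h
  exact ⟨p, hp, hW, hP, hPI, fun hG => hPI (pialtAt_of_gqaAt_of_wqAt hG hW)⟩

/-- `¬ SummitReduction → ¬ GaloisQuotientAlteration`. -/
theorem not_galoisQuotientAlteration_of_not_summitReduction (h : ¬ SummitReduction) :
    ¬ GaloisQuotientAlteration := by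
  obtain ⟨p, hp, -, -, -, hG⟩ := exists_not_gqaAt_of_not_summitReduction h
  exact fun hGQA => hG (hGQA p hp)

/-! ## §C Load-bearing hypotheses -/

/-- The crux with the antecedent `PICover_p` dropped. -/
def SummitReductionWithoutPicover : Prop :=
  ∀ p : ℕ, p.Prime → WQAt p → ResolutionInChar.{0} p

/-- The crux with the antecedent `WQ_p` dropped. -/
def SummitReductionWithoutWQ : Prop :=
  ∀ p : ℕ, p.Prime → PicoverAt p → ResolutionInChar.{0} p

/-- **Dropping Picover = asking WQ alone for Abramovich–Oort AND the inseparable residue**: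
`SummitReductionWithoutPicover ↔ ∀ p prime, WQ_p → PIAlt_p ∧ PICover_p`. Modulo de Jong
(`WQ_p → PIAlt_p`) this is `WQ ⇒ Picover` — the classical death point of the alteration programme
(de Jong 1997 Cor 5.15: "up to … a purely inseparable extension of `R(X)`"). Open; not refutable here
(its negation contains `¬ ResolutionInChar p`). -/
theorem withoutPicover_iff :
    SummitReductionWithoutPicover ↔ ∀ p : ℕ, p.Prime → WQAt p → PialtAt p ∧ PicoverAt p := by
  constructor
  · intro h p hp hW
    exact ⟨pialtAt_of_resolutionInChar (h p hp hW), picoverAt_of_resolutionInChar (h p hp hW)⟩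
  · intro h p hp hW
    obtain ⟨hPI, hPC⟩ := h p hp hW
    exact resolutionInChar_of_pialtAt_of_picoverAt hp hPI hPC

/-- **Dropping WQ = asking Picover alone for Abramovich–Oort**:
`SummitReductionWithoutWQ ↔ ∀ p prime, PICover_p → PIAlt_p`. Open; not refutable here. -/
theorem withoutWQ_iff :
    SummitReductionWithoutWQ ↔ ∀ p : ℕ, p.Prime → PicoverAt p → PialtAt p := by
  constructor
  · intro h p hp hP
    exact pialtAt_of_resolutionInChar (h p hp hP)
  · intro h p hp hP
    exact resolutionInChar_of_pialtAt_of_picoverAt hp (h p hp hP) hP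

/-- Either weakening still only fails at a counterexample to resolution of singularities. -/
theorem not_resolutionOfSingularities_of_not_withoutPicover (h : ¬ SummitReductionWithoutPicover) :
    ¬ _root_.ResolutionOfSingularities :=
  fun hR => h fun p hp _ => (_root_.ResolutionOfSingularities_iff.mp hR) p hp

theorem not_resolutionOfSingularities_of_not_withoutWQ (h : ¬ SummitReductionWithoutWQ) :
    ¬ _root_.ResolutionOfSingularities :=
  fun hR => h fun p hp _ => (_root_.ResolutionOfSingularities_iff.mp hR) p hp

/-- The crux over ALL naturals (hypothesis `p.Prime` dropped). -/
def SummitReductionAllNat : Prop :=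
  ∀ p : ℕ, WQAt p → PicoverAt p → ResolutionInChar.{0} p

/-- **`p.Prime` is not load-bearing**: a non-prime `p ≠ 0` is the characteristic of no field (all
three statements are vacuous there), and `p = 0` adds one characteristic-zero instance
(tame quotients + de Jong ⇒ weak Hironaka; true by `Hironaka1964`, not needed here). -/
theorem allNat_iff :
    SummitReductionAllNat ↔ SummitReduction ∧ (WQAt 0 → PicoverAt 0 → ResolutionInChar.{0} 0) := by
  constructor
  · exact fun h => ⟨fun p _ => h p, h 0⟩
  · rintro ⟨h, h0⟩ p hW hP
    by_cases hp : p.Prime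
    · exact h p hp hW hP
    · intro k _ _ X f hs hl hq hr
      rcases CharP.char_is_prime_or_zero k p with hp' | rfl
      · exact absurd hp' hp
      · exact h0 hW hP k X f hs hl hq hr

/-- `WQ_p` with the upstairs regularity `Scheme.IsRegular X'` DELETED. -/
def WQNoRegAt (p : ℕ) : Prop :=
  ∀ (k : Type) [Field k] [CharP k p] (X' X₁ : Scheme.{0}) (f : X₁ ⟶ Spec (.of k)) (q : X' ⟶ X₁)
    (G : Type) [Group G] [Finite G] (ρ : G →* Aut X'), IsSeparated f → LocallyOfFiniteType f →
    QuasiCompact f → IsIntegral X₁ → IsIntegral X' → IsFinite q →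
    Function.Surjective q.base → (∃ U : X₁.Opens, Dense (U : Set X₁) ∧ Etale (q ∣_ U)) →
    (∀ g : G, (ρ g).hom ≫ q = q) → (∀ x y : X', q.base x = q.base y → ∃ g : G, (ρ g).hom.base x = y) →
    Scheme.HasResolution X₁

/-- **Inside the antecedent, `Scheme.IsRegular X'` is what gives the crux content**: with it deleted
the reduction is TRIVIAL — present any integral `X` as its own quotient by the trivial group
(`X' = X₁ = X`, `q = 𝟙`, `G = 1`: finite, surjective, étale, invariant, fibres = orbits) and descend
reduced → integral; Picover is not even used. (So that version of WQ is the summit in costume.) -/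
theorem summitReduction_trivial_without_isRegular_upstairs :
    ∀ p : ℕ, p.Prime → WQNoRegAt p → PicoverAt p → ResolutionInChar.{0} p := by
  intro p _ hW _ k _ _ X f hs hl hq hr
  refine Theses.PAlteration.DescentReducedToIntegral_holds k ?_ X f hs hl hq hr
  intro Y g hs' hl' hq' hi'
  have h1 : ((1 : PUnit →* Aut Y) PUnit.unit).hom = 𝟙 Y := rfl
  refine hW k Y Y g (𝟙 Y) PUnit (1 : PUnit →* Aut Y) hs' hl' hq' hi' hi' inferInstance
    (fun y => ⟨y, rfl⟩) ⟨⊤, by simp, inferInstance⟩ (fun _ => by rw [h1, Category.comp_id]) ?_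
  intro x y hxy
  exact ⟨1, by rw [h1]; exact hxy⟩

/-- `WQ_p` with the upstairs surjectivity `Function.Surjective q.base` DELETED. -/
def WQNoSurjAt (p : ℕ) : Prop :=
  ∀ (k : Type) [Field k] [CharP k p] (X' X₁ : Scheme.{0}) (f : X₁ ⟶ Spec (.of k)) (q : X' ⟶ X₁)
    (G : Type) [Group G] [Finite G] (ρ : G →* Aut X'), IsSeparated f → LocallyOfFiniteType f →
    QuasiCompact f → IsIntegral X₁ → IsIntegral X' → Scheme.IsRegular X' → IsFinite q →
    (∃ U : X₁.Opens, Dense (U : Set X₁) ∧ Etale (q ∣_ U)) →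
    (∀ g : G, (ρ g).hom ≫ q = q) → (∀ x y : X', q.base x = q.base y → ∃ g : G, (ρ g).hom.base x = y) →
    Scheme.HasResolution X₁

/-- **Inside the antecedent, `Function.Surjective q.base` is what excludes the closed-point junk**:
with it deleted the reduction is again TRIVIAL — for an integral `X` with a closed point `x` and
`X ≠ {x}` take `X' = Spec κ(x)` (integral, zero-dimensional hence regular), `q` the closed immersion
(finite), `G = 1`, `U = X ∖ {x}` (dense; `q` has EMPTY source over `U`, so it is étale there); fibres
are orbits because `X'` is one point. If `X = {x}` then `X` is zero-dimensional, hence regular.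
(So that version of WQ is the summit in costume, too.) -/
theorem summitReduction_trivial_without_surjective_upstairs :
    ∀ p : ℕ, p.Prime → WQNoSurjAt p → PicoverAt p → ResolutionInChar.{0} p := by
  intro p _ hW _ k _ _ X f hs hl hq hr
  refine Theses.PAlteration.DescentReducedToIntegral_holds k ?_ X f hs hl hq hr
  intro Y g hs' hl' hq' hi'
  haveI := hq'
  haveI : CompactSpace Y := QuasiCompact.compactSpace_of_compactSpace g
  obtain ⟨x, -, hx⟩ :=
    (isClosed_univ : IsClosed (Set.univ : Set Y)).exists_closed_singleton Set.univ_nonempty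
  by_cases hY : ∃ y : Y, y ≠ x
  · haveI : IsClosedImmersion (Y.fromSpecResidueField x) :=
      isClosed_singleton_iff_isClosedImmersion.mp hx
    let U : Y.Opens := ⟨{x}ᶜ, hx.isOpen_compl⟩
    have hU : Dense (U : Set Y) := by
      obtain ⟨y, hy⟩ := hY
      exact U.isOpen.dense ⟨y, Set.mem_compl_singleton_iff.mpr hy⟩
    haveI : IsEmpty (↑((Y.fromSpecResidueField x) ⁻¹ᵁ U) : Scheme.{0}) := ⟨fun s => by
      have h1 : (Y.fromSpecResidueField x).base s.1 ∈ (U : Set Y) := s.2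
      have h2 : (Y.fromSpecResidueField x).base s.1 = x := Y.fromSpecResidueField_apply x s.1
      rw [h2] at h1
      exact h1 rfl⟩
    have h1 : ((1 : PUnit →* Aut (Spec (Y.residueField x))) PUnit.unit).hom = 𝟙 _ := rfl
    refine hW k _ Y g (Y.fromSpecResidueField x) PUnit 1 hs' hl' hq' hi' inferInstance
      (Scheme.IsRegular.of_topologicalKrullDim_le_zero
        (topologicalKrullDim_zero_of_discreteTopology _))
      inferInstance ⟨U, hU, inferInstance⟩ (fun _ => by rw [h1, Category.id_comp]) ?_
    intro a b _
    exact ⟨1, Subsingleton.elim _ _⟩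
  · -- `Y = {x}` is a zero-dimensional integral scheme, hence regular
    push Not at hY
    haveI : Subsingleton Y := ⟨fun a b => (hY a).trans (hY b).symm⟩
    exact (Scheme.IsRegular.of_topologicalKrullDim_le_zero
      (topologicalKrullDim_zero_of_discreteTopology _)).hasResolution

/-! ## Targets

(no stub signatures registered yet — line `FramePerfect` picked 2026-08-16T22:28Z; this section
receives `theorem <stub>_false : ¬ <stub statement>` attempts on re-arm.) -/

end Summit.ResolutionOfSingularities.ResolutionOfSingularities.Cruxes.SummitReduction.Disproof

end
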